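import Summits.NavierStokesRegularity.FluidComputer.ClayBlowupWindows
import HarnessLib

/-!
# Tao-class RE-PRESSURISATION of a Clay blow-up on every closed sub-slab

Cell `ns-blowup`, seat `ns-blowup-ecbridge-2` (g5; the E–C endpoint theory seat). LABEL: E–C typing
(KERNEL — no named fact). WHAT THIS IS NOT: not Navier–Stokes evidence — a regularity statement
about the TYPE `ClayBlowup` (no inhabitant is claimed anywhere). Companion memo:
`run/shared/lean/pub/ns-blowup/ecbridge2/ECBRIDGE-2-MEMO-4.md`.

## Content

The Serrin-scale rows of the compatibility list (Sohr corner, Type-II floor, no sub-Leray rate)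
were, up to now, stated under a hypothesis on the pressure GAUGE (normalised pressure, or a
Tao-class pressure with `∂ₜu` in Tao's class): the forced Serrin–Grönwall inequality integrates
`∂ₜu` and `∇p` against `Δu`. This file removes the hypothesis: the pressure of ANY Clay blow-up can
be replaced, on every closed sub-slab `[0, T']`, `T' < T`, by a Tao-class one.

**`ClayBlowup.exists_taoPressure`** — for `ν > 0` and `0 < T' < T` there is `p'` with `(u, p')`
classical on `[0, T'] × ℝ³`, `∂ₜu ∈ L^∞_t H^k_x([0, T'])` and `p' ∈ L^∞_t H^k_x([0, T'])` for every
`k`. Construction: the uniform windows of `ClayBlowupWindows.lean` on the grid `[k h/2, k h/2 + h]`,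
window index `⌊2t/h − 1/2⌋₊` (every time is `h/4`-interior to its window); the glued pressure is
locally ONE window's pressure by gauge rigidity; finitely many windows give uniform constants; the
one-sided time derivative within `[0, T']` is the window's (sets coinciding near `t = 0`, two-sided
derivatives at `t > 0`).

Consumer: `ClayBlowupSerrin.lean` (the Serrin-scale rows on `ClayBlowup` with NO pressure hypothesis).

References: T. Tao, Anal. PDE 6 (2013), Thm. 5.4, Lemma 4.1 (i) [cite: Tao2011, Thm. 5.4 (ii)+(iv)];
J. T. Beale, T. Kato, A. Majda, Comm. Math. Phys. 94 (1984) §1 [cite: BealeKatoMajda1984, §1].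
-/

noncomputable section

namespace Summit.NavierStokesRegularity.FluidComputer

open Set MeasureTheory Filter Topology Function
open scoped ENNReal ContDiff NNReal
open Literature.Analysis.FluidPDE
open Summit.NavierStokesRegularity.NavierStokesRegularity
open Summit.NavierStokesRegularity.FluidComputer.PalasekTowerClayBridge

namespace ClayBlowup

variable {ν : ℝ} (X : ClayBlowup ν)

/-- `∫ ‖g‖² = ∫ ‖D⁰ g‖²` (scalar). [folklore] -/
private theorem lintegral_enorm_sq_eq_iteratedFDeriv_zero_real' (g : EuclideanSpace ℝ (Fin 3) → ℝ) :
    ∫⁻ x, ‖g x‖ₑ ^ 2 = ∫⁻ x, ‖iteratedFDeriv ℝ 0 g x‖ₑ ^ 2 :=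
  lintegral_congr fun x => by rw [← ofReal_norm, ← ofReal_norm, norm_iteratedFDeriv_zero]

/-- **TAO-CLASS RE-PRESSURISATION ON CLOSED SUB-SLABS.** For a Clay blow-up at `ν > 0` and every
`0 < T' < T` there is a pressure `p'` such that `(u, p')` is a classical solution of the forced
system on the CLOSED slab `[0, T'] × ℝ³`, the one-sided time derivative `∂ₜu` (within `[0, T']`) has
bounded `L²` Sobolev norms of every order on `[0, T']`, and so does `p'`. (The blow-up's own pressure
is `p' + c(t)`; no hypothesis on it is needed.) No named fact. [cite: Tao2011, Thm. 5.4 (ii)+(iv)]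
[cite: Tao2011, Lemma 4.1 (i)] -/
theorem exists_taoPressure (hν : 0 < ν) {T' : ℝ} (hT'0 : 0 < T') (hT' : T' < X.T) :
    ∃ p' : ℝ → EuclideanSpace ℝ (Fin 3) → ℝ,
      IsClassicalNSSolutionOn (Icc 0 T') ν X.f X.u p' ∧
      HasBoundedSobolevNormsOn (Icc 0 T') (timeDerivWithin (Icc 0 T') X.u) ∧
      ∀ n : ℕ, ∃ C : ℝ≥0, ∀ t ∈ Icc 0 T', ∫⁻ x, ‖iteratedFDeriv ℝ n (p' t) x‖ₑ ^ 2 ≤ C := by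
  -- an intermediate sub-slab `[0, T'']`
  set T'' : ℝ := (T' + X.T) / 2 with hT''def
  have hT'T'' : T' < T'' := by rw [hT''def]; linarith
  have hT''T : T'' < X.T := by rw [hT''def]; linarith
  have hT''0 : 0 < T'' := hT'0.trans hT'T''
  -- uniform windows with `h ≤ T'' - T'`
  obtain ⟨h, hh, hhle, hwin⟩ := X.exists_uniform_windows hν hT''0 hT''T (sub_pos.2 hT'T'')
  choose! w q hcl hwS' hqS hwu using hwin
  choose! Cw hCw using hwS'
  choose! Cq hCq using hqS
  -- the grid of windows `[a k, a k + h]`, `a k = k h/2`, and the absolute-time fields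
  set a : ℕ → ℝ := fun k => (k : ℝ) * (h / 2) with ha
  set U : ℕ → ℝ → EuclideanSpace ℝ (Fin 3) → EuclideanSpace ℝ (Fin 3) :=
    fun k t => w (a k) (t + -(a k)) with hU
  set P : ℕ → ℝ → EuclideanSpace ℝ (Fin 3) → ℝ := fun k t => q (a k) (t + -(a k)) with hP
  -- the window index
  set idx : ℝ → ℕ := fun t => Nat.floor (2 * t / h - 1 / 2) with hidx
  have ha_nonneg : ∀ k, 0 ≤ a k := fun k => by simp only [ha]; positivity
  have hidx_mono : ∀ {s t : ℝ}, s ≤ t → idx s ≤ idx t := fun hst => by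
    simp only [hidx]
    exact Nat.floor_le_floor (by
      have := div_le_div_of_nonneg_right (mul_le_mul_of_nonneg_left hst zero_le_two) hh.le
      linarith)
  have hbounds : ∀ {t : ℝ}, 0 ≤ t →
      a (idx t) ≤ t ∧ t < a (idx t) + 3 * h / 4 ∧ (1 ≤ idx t → a (idx t) + h / 4 ≤ t) :=
    fun ht => window_index_bounds hh ht
  -- the windows used on `[0, T']` start inside `[0, T'']`
  have ha_mem : ∀ {t : ℝ}, t ∈ Icc 0 T' → a (idx t) ∈ Icc 0 T'' := fun ht =>
    ⟨ha_nonneg _, ((hbounds ht.1).1.trans ht.2).trans hT'T''.le⟩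
  -- (A1) each window is a classical solution with force `f` in absolute time
  have hSet : ∀ k, ((fun x : ℝ => x + -(a k)) ⁻¹' Icc 0 h) = Icc (a k) (a k + h) := fun k => by
    ext t
    simp only [mem_preimage, mem_Icc]
    constructor <;> rintro ⟨h1, h2⟩ <;> constructor <;> linarith
  have hUP : ∀ k, a k ∈ Icc 0 T'' → IsClassicalNSSolutionOn (Icc (a k) (a k + h)) ν X.f (U k) (P k) := by
    intro k hk
    have h1 := (hcl (a k) hk).comp_add_right (-(a k))
    have hf : (fun t => (fun s => X.f (s + a k)) (t + -(a k))) = X.f := by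
      funext t; simp only [neg_add_cancel_right]
    rw [hSet k, hf] at h1
    exact h1
  -- (A2) each window is the blow-up on its window, up to `T''`
  have hUu : ∀ k, a k ∈ Icc 0 T'' → ∀ t ∈ Icc (a k) (a k + h), t ≤ T'' → U k t = X.u t := by
    intro k hk t ht htT
    have h1 := hwu (a k) hk (t + -(a k)) ⟨by linarith [ht.1], by linarith [ht.2]⟩ (by linarith)
    simp only [hU]
    rw [h1, neg_add_cancel_right]
  -- (A3) the window pressures are `L²`
  have hPL2 : ∀ k, a k ∈ Icc 0 T'' → ∀ t ∈ Icc (a k) (a k + h), ∫⁻ x, ‖P k t x‖ₑ ^ 2 < ⊤ := by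
    intro k hk t ht
    have h1 := hCq (a k) hk 0 (t + -(a k)) ⟨by linarith [ht.1], by linarith [ht.2]⟩
    simp only [hP]
    rw [lintegral_enorm_sq_eq_iteratedFDeriv_zero_real']
    exact h1.trans_lt ENNReal.coe_lt_top
  -- (G) gauge rigidity: two windows containing `t < T''` in their interior have the same pressure at `t`
  have hG : ∀ j k, a j ∈ Icc 0 T'' → a k ∈ Icc 0 T'' → ∀ t, a j < t → t < a j + h → a k < t →
      t < a k + h → t < T'' → P j t = P k t := by
    intro j k hj hk t hj1 hj2 hk1 hk2 htT
    have hm : t < min (min (a j + h) (a k + h)) T'' := lt_min (lt_min hj2 hk2) htT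
    have hev : ∀ᶠ τ in 𝓝 t, U j τ = U k τ := by
      filter_upwards [Ioo_mem_nhds (max_lt hj1 hk1) hm] with τ hτ
      have hτ1 : a j < τ := (le_max_left _ _).trans_lt hτ.1
      have hτ2 : a k < τ := (le_max_right _ _).trans_lt hτ.1
      have hτ3 : τ < a j + h := hτ.2.trans_le ((min_le_left _ _).trans (min_le_left _ _))
      have hτ4 : τ < a k + h := hτ.2.trans_le ((min_le_left _ _).trans (min_le_right _ _))
      have hτ5 : τ ≤ T'' := (hτ.2.trans_le (min_le_right _ _)).le
      rw [hUu j hj τ ⟨hτ1.le, hτ3.le⟩ hτ5, hUu k hk τ ⟨hτ2.le, hτ4.le⟩ hτ5]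
    exact pressure_eq_of_eventuallyEq_of_sq_integrable (hUP j hj) (hUP k hk)
      (Icc_mem_nhds hj1 hj2) (Icc_mem_nhds hk1 hk2) hev (hPL2 j hj t ⟨hj1.le, hj2.le⟩)
      (hPL2 k hk t ⟨hk1.le, hk2.le⟩)
  -- the glued pressure
  set p' : ℝ → EuclideanSpace ℝ (Fin 3) → ℝ := fun t => P (idx t) t with hp'
  -- (L) local representation: near `t₀` the glued pressure is the window `idx t₀`
  have hwin_t : ∀ {t₀ t : ℝ}, 0 ≤ t₀ → 0 ≤ t → t₀ - h / 4 < t → t < t₀ + h / 4 →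
      a (idx t₀) ≤ t ∧ t < a (idx t₀) + h ∧ (0 < t → a (idx t₀) < t) := by
    intro t₀ t ht₀ ht hlo hhi
    obtain ⟨hb1, hb2, hb3⟩ := hbounds ht₀
    refine ⟨?_, by linarith, fun htpos => ?_⟩
    · rcases Nat.lt_or_ge (idx t₀) 1 with h0 | h1
      · have : idx t₀ = 0 := by omega
        simp only [ha, this, Nat.cast_zero, zero_mul]; exact ht
      · linarith [hb3 h1]
    · rcases Nat.lt_or_ge (idx t₀) 1 with h0 | h1
      · have : idx t₀ = 0 := by omega
        simp only [ha, this, Nat.cast_zero, zero_mul]; exact htpos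
      · linarith [hb3 h1]
  have hL : ∀ {t₀ t : ℝ}, t₀ ∈ Icc 0 T' → t ∈ Icc 0 T' → t₀ - h / 4 < t → t < t₀ + h / 4 →
      p' t = P (idx t₀) t := by
    intro t₀ t ht₀ ht hlo hhi
    rcases ht.1.eq_or_lt with h0 | htpos
    · -- `t = 0`: both indices vanish
      have hi0 : idx t = 0 := by
        simp only [hidx, ← h0]; exact Nat.floor_eq_zero.2 (by norm_num)
      have hi1 : idx t₀ = 0 := by
        simp only [hidx]
        refine Nat.floor_eq_zero.2 ?_
        have : 2 * t₀ / h < 1 / 2 := by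
          rw [div_lt_iff₀ hh]; linarith
        linarith
      simp only [hp', hi0, hi1]
    · obtain ⟨hc1, hc2, hc3⟩ := hwin_t ht₀.1 ht.1 hlo hhi
      obtain ⟨hb1, hb2, hb3⟩ := hbounds ht.1
      have hown : a (idx t) < t := by
        rcases Nat.lt_or_ge (idx t) 1 with h0 | h1
        · have : idx t = 0 := by omega
          simp only [ha, this, Nat.cast_zero, zero_mul]; exact htpos
        · linarith [hb3 h1]
      exact hG (idx t) (idx t₀) (ha_mem ht) (ha_mem ht₀) t hown (by linarith) (hc3 htpos) hc2
        (ht.2.trans_lt hT'T'')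
  -- (D) transport of the one-sided time derivative from a window to `[0, T']`
  have hD : ∀ t ∈ Icc 0 T', ∀ x,
      timeDerivWithin (Icc (a (idx t)) (a (idx t) + h)) (U (idx t)) t x =
        timeDerivWithin (Icc 0 T') X.u t x := by
    intro t ht x
    have hk := ha_mem ht
    obtain ⟨hb1, hb2, hb3⟩ := hbounds ht.1
    simp only [timeDerivWithin_apply]
    rcases ht.1.eq_or_lt with h0 | htpos
    · -- `t = 0`: the window is `[0, h]`; both sets look like `[0, ε)` near `0`
      subst h0
      have hi0 : idx 0 = 0 := by
        simp only [hidx, mul_zero, zero_div, zero_sub]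
        exact Nat.floor_eq_zero.2 (by norm_num)
      have ha0 : a (idx 0) = 0 := by simp only [ha, hi0, Nat.cast_zero, zero_mul]
      set m : ℝ := min h T' with hm
      have hm0 : 0 < m := lt_min hh hT'0
      have hI1 : Icc 0 h ∩ Iio m = Ico 0 m := by
        ext s; simp only [mem_inter_iff, mem_Icc, mem_Iio, mem_Ico]
        exact ⟨fun h' => ⟨h'.1.1, h'.2⟩, fun h' => ⟨⟨h'.1, (h'.2.trans_le (min_le_left _ _)).le⟩, h'.2⟩⟩
      have hI2 : Icc 0 T' ∩ Iio m = Ico 0 m := by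
        ext s; simp only [mem_inter_iff, mem_Icc, mem_Iio, mem_Ico]
        exact ⟨fun h' => ⟨h'.1.1, h'.2⟩, fun h' => ⟨⟨h'.1, (h'.2.trans_le (min_le_right _ _)).le⟩, h'.2⟩⟩
      have hEq : ∀ s ∈ Ico 0 m, U (idx 0) s x = X.u s x := fun s hs => by
        have := hUu (idx 0) hk s
          (by rw [ha0, zero_add]; exact ⟨hs.1, (hs.2.trans_le (min_le_left _ _)).le⟩)
          ((hs.2.trans_le (min_le_right _ _)).le.trans hT'T''.le)
        exact congrFun this x
      have h00 : U (idx 0) 0 x = X.u 0 x := hEq 0 ⟨le_rfl, hm0⟩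
      rw [ha0, zero_add]
      calc derivWithin (fun s => U (idx 0) s x) (Icc 0 h) 0
          = derivWithin (fun s => U (idx 0) s x) (Ico 0 m) 0 := by
            rw [← hI1]; exact (derivWithin_inter (Iio_mem_nhds hm0)).symm
        _ = derivWithin (fun s => X.u s x) (Ico 0 m) 0 := derivWithin_congr hEq h00
        _ = derivWithin (fun s => X.u s x) (Icc 0 T') 0 := by
            rw [← hI2]; exact derivWithin_inter (Iio_mem_nhds hm0)
    · -- `0 < t ≤ T'`: interior of the window; `u` is differentiable at `t`
      have hown : a (idx t) < t := by
        rcases Nat.lt_or_ge (idx t) 1 with h0 | h1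
        · have : idx t = 0 := by omega
          simp only [ha, this, Nat.cast_zero, zero_mul]; exact htpos
        · linarith [hb3 h1]
      have hup : t < a (idx t) + h := by linarith
      have hev : (fun s => U (idx t) s x) =ᶠ[𝓝 t] fun s => X.u s x := by
        filter_upwards [Ioo_mem_nhds hown (lt_min hup (ht.2.trans_lt hT'T''))] with s hs
        rw [hUu (idx t) hk s ⟨hs.1.le, (hs.2.trans_le (min_le_left _ _)).le⟩
          (hs.2.trans_le (min_le_right _ _)).le]
      have hdiff : DifferentiableAt ℝ (fun s => X.u s x) t :=
        (X.classical.smooth_velocity.differentiableWithinAt_time ⟨ht.1, ht.2.trans_lt hT'⟩ x).differentiableAt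
          (Ico_mem_nhds htpos (ht.2.trans_lt hT'))
      rw [derivWithin_of_mem_nhds (Icc_mem_nhds hown hup), hev.deriv_eq,
        hdiff.derivWithin (uniqueDiffOn_Icc hT'0 t ht)]
  refine ⟨p', ⟨?_, ?_, ?_, ?_⟩, ?_, ?_⟩
  · -- smoothness of `u` on the closed sub-slab
    exact (X.classical_Icc hT'0 hT').smooth_velocity
  · -- smoothness of the glued pressure: locally it is one window's pressure
    refine contDiffOn_of_locally_contDiffOn fun z hz => ?_
    obtain ⟨t₀, x₀⟩ := z
    have ht₀ : t₀ ∈ Icc 0 T' := hz.1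
    refine ⟨Ioo (t₀ - h / 4) (t₀ + h / 4) ×ˢ univ, isOpen_Ioo.prod isOpen_univ,
      ⟨⟨by linarith, by linarith⟩, mem_univ _⟩, ?_⟩
    have hsub : (Icc 0 T' ×ˢ (univ : Set (EuclideanSpace ℝ (Fin 3)))) ∩
        Ioo (t₀ - h / 4) (t₀ + h / 4) ×ˢ univ ⊆ Icc (a (idx t₀)) (a (idx t₀) + h) ×ˢ univ := by
      rintro ⟨s, y⟩ ⟨hs1, hs2⟩
      obtain ⟨hc1, hc2, -⟩ := hwin_t ht₀.1 hs1.1.1 hs2.1.1 hs2.1.2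
      exact ⟨⟨hc1, hc2.le⟩, mem_univ _⟩
    refine (ContDiffOn.mono (hUP (idx t₀) (ha_mem ht₀)).smooth_pressure hsub).congr fun z hz' => ?_
    obtain ⟨s, y⟩ := z
    have hs : s ∈ Icc 0 T' := hz'.1.1
    simp only [uncurry_apply_pair]
    rw [hL ht₀ hs hz'.2.1.1 hz'.2.1.2]
  · -- the momentum equation: that of the window `idx t`, transported
    intro t ht x
    have hk := ha_mem ht
    obtain ⟨hb1, hb2, -⟩ := hbounds ht.1
    have htI : t ∈ Icc (a (idx t)) (a (idx t) + h) := ⟨hb1, by linarith⟩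
    have hm := (hUP (idx t) hk).momentum t htI x
    rw [hD t ht x, hUu (idx t) hk t htI (ht.2.trans hT'T''.le)] at hm
    exact hm
  · -- incompressibility
    intro t ht
    exact X.classical.divFree t ⟨ht.1, ht.2.trans_lt hT'⟩
  · -- `∂ₜu` in Tao's class on `[0, T']`: window bounds, finitely many windows
    intro n
    refine ⟨(Finset.range (idx T' + 1)).sup fun k => Cw (a k) n, fun t ht => ?_⟩
    have hk := ha_mem ht
    obtain ⟨hb1, hb2, -⟩ := hbounds ht.1
    have hfun : timeDerivWithin (Icc 0 T') X.u t =
        timeDerivWithin (Icc 0 h) (w (a (idx t))) (t + -(a (idx t))) := by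
      funext x
      rw [← hD t ht x, ← hSet (idx t)]
      exact timeDerivWithin_comp_add_right (Icc 0 h) (w (a (idx t))) (-(a (idx t))) t x
    rw [hfun]
    refine (hCw (a (idx t)) hk n (t + -(a (idx t))) ⟨by linarith, by linarith⟩).trans ?_
    exact_mod_cast Finset.le_sup (f := fun k => Cw (a k) n)
      (Finset.mem_range.2 (Nat.lt_succ_of_le (hidx_mono ht.2)))
  · -- the glued pressure in Tao's class on `[0, T']`
    intro n
    refine ⟨(Finset.range (idx T' + 1)).sup fun k => Cq (a k) n, fun t ht => ?_⟩
    have hk := ha_mem ht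
    obtain ⟨hb1, hb2, -⟩ := hbounds ht.1
    have hval : p' t = q (a (idx t)) (t + -(a (idx t))) := rfl
    rw [hval]
    refine (hCq (a (idx t)) hk n (t + -(a (idx t))) ⟨by linarith, by linarith⟩).trans ?_
    exact_mod_cast Finset.le_sup (f := fun k => Cq (a k) n)
      (Finset.mem_range.2 (Nat.lt_succ_of_le (hidx_mono ht.2)))

end ClayBlowup

end Summit.NavierStokesRegularity.FluidComputer

end
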